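import Summits.BirchSwinnertonDyer.Rank1Residual.X11b.RouteR1BaseSelmerCount
import Summits.BirchSwinnertonDyer.Rank1Residual.X11b.BDPRouteNonsingularTorsionDivisible
import Summits.BirchSwinnertonDyer.Rank1Residual.X11b.AnticyclotomicControlLocallyTrivialClass
import HarnessLib

/-!
# X11b, route R1 — the local Tamagawa atom (P11) PROVED wherever `p ∤ c_w(E/K)`: (P11) leaves the
# statement of record on the whole "Tamagawa-prime-to-`p`" population (no torsion condition)

HONEST FRAMING (cell `b2b-bsdres`, run/shared/lean/b2b/bsd-rank1-residual/, verbatim in every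
file): the goal of the cell is to DELETE the COMBINATION-SHAPED residual classes of the
Birch–Swinnerton-Dyer formula for ALL analytic-rank `≤ 1` elliptic curves over `ℚ` — "full BSD
formula for every rank `≤ 1` curve in class `C`" assembled STRICTLY from published theorems — so
that the rank-`≤ 1` remainder becomes exactly the CONSTRUCTION-SHAPED classes, which are TYPED
(missing-input `Prop`s), NOT attempted. This is not "finishing BSD". Sub-cell
`b2b-bsdres-multr1-p1` (X11b, route R1 = Castella 2018 Thm. A re-proved along the author's
erratum); a RESEARCH ROUTE; no claim beyond the stated class; X11b stays CONSTRUCTION-SHAPED;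
nothing here changes a label; no named fact is minted (theorems only; no `sorry`).

## What this file proves

Gen 12 (`AnticyclotomicLocalKernelTrivial`) settled the local atom (P11) `LocalKernelOrderAt E p κ w`
(JSW17 Prop. 3.3.4 Case 1(a) / Greenberg LNM 1716 pp. 74–75: `#ker r_w = c_w^{(p)}`,
`r_w : H¹(K_w, E[p^∞]) → H¹(K_{∞,η}, E[p^∞])`) where BOTH `E(K_w)[p] = 0` AND `p ∤ c_w(E/K)`.
Route p2 (multr1-p2 gen 14, `BDPRouteNonsingularTorsionDivisible`) has since proved Greenberg's
Lemma 3.3 with the Tamagawa BOUND unconditionally on the constructed objects: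
`ker r_w` is finite and `#ker r_w ≤ p ^ ord_p c_w(E/K)` at every finite `w ∤ p`, every `E/K`, every
`ℤ_p`-extension `κ` (`AcSelmer.natCard_localKer_le_pow_padicValNat_localTamagawaNumber`).
Hence the torsion condition is idle:

* `localKernelOrderAt_of_not_dvd_localTamagawaNumber` — **`p ∤ c_w(E/K) ⟹ (P11) at `w`** (a finite
  group of order `≤ p⁰` has order `1 = p⁰`), for EVERY `E/K`, `κ`, `w ∤ p` — in particular at the
  places where `E(K_w)[p] ≠ 0` (`p ∣ #Ẽ_ns(k_w)`: the `μ`/torus part of `E(K_{∞,η})[p^∞]`, which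
  `γ_w − 1` divides);
* `not_dvd_localTamagawaNumber_nPlusPlaces` — at `w ∈ Σ(N⁺)` (above `ℓ ∣ N_E`, `ℓ ≠ p`, split in the
  quadratic `K`) `c_w(E/K) = c_ℓ(E)`, so "`p ∤ c_ℓ(E)` for every `ℓ ∣ N_E`, `ℓ ≠ p`" puts every
  `w ∈ Σ(N⁺)` in the case above;
* **`r1LocalKernelOrderAt_of_forall_not_dvd_tamagawa`** — `(∀ ℓ ∣ N_E, ℓ ≠ p, p ∤ c_ℓ(E)) →
  R1LocalKernelOrderAt W p`: the class-level atom (P11) of route R1 is a THEOREM on the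
  Tamagawa-prime-to-`p` population (decidable per pair from Cremona's `c_ℓ`; no condition on
  `#E(ℚ_ℓ)[p]`, i.e. none on `ℓ ∓ 1 mod p`);
* **`R1.bsdp_of_onTree_facts_of_tamagawa`** — the statement of record `R1.bsdp_of_onTree_facts`
  (gen 17: nine published facts, four cited cohomological facts, (P11) off the locally-trivial pairs,
  the ONE open input) with (P11) now consumed ONLY on the pairs with `p ∣ c_ℓ(E)` for some bad
  `ℓ ≠ p` (there `ℓ` is split multiplicative with `p ∣ ord_ℓ(Δ_E)`, since `p ≥ 5` exceeds every
  additive `c_ℓ ≤ 4` and every non-split `c_ℓ ≤ 2`); `R1.bsdp_of_onTree_facts_of_forall_tamagawa` —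
  the family form with NO (P11) input when every pair is Tamagawa-prime-to-`p`.

What is NOT here: (P11) at a place `w` with `p ∣ c_w(E/K)` — the EXACT count `#ker r_w = c_w^{(p)}`,
which needs `w` finitely decomposed in `K_∞` (class field theory for the anticyclotomic tower) and the
lower bound (component group of the Tate curve); gen 17's `ProcyclicDescentKernel` is its Step 1a.

References: [JetchevSkinnerWan2017] Prop. 3.3.4 (arXiv:1512.06894 pp. 12–13); [GreenbergLNM1716] §3
pp. 74–75, Lemma 3.3 (p. 87), §4 proof of Thm. 4.1; [Castella2018] Thm. 2.3, §5 (arXiv:1704.06608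
pp. 5, 12); [Castella2018Erratum] Thm. 1.1, Thm. A′ (p. 1).
-/

noncomputable section

open scoped Classical

open WeierstrassCurve NumberField IsDedekindDomain Field
open Literature.NumberTheory.EllipticCurves Literature.NumberTheory.EllipticCurves.GreenbergSelmer
open Literature.NumberTheory.EllipticCurves.ModularForms
open Literature.NumberTheory.EllipticCurves.Rank1Residual
open Literature.NumberTheory.EllipticCurves.Rank1Residual.Typed
open Literature.NumberTheory.GaloisRepresentations
open Literature.NumberTheory.GaloisCohomology
open Summit.BirchSwinnertonDyer.Rank1Residual.X11b.AcSelmer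

namespace Summit.BirchSwinnertonDyer.Rank1Residual.X11b

/-! ## (P11) at a place with `p ∤ c_w(E/K)` -/

section Local

variable {K : Type} [Field K] [NumberField K] {p : ℕ} [Fact p.Prime]

/-- **(P11) wherever the Tamagawa number is prime to `p`.**  For every elliptic curve `E` over a
number field `K`, every `ℤ_p`-extension `κ` of `K` and every finite place `w ∤ p` with
`p ∤ c_w(E/K)`: `ker(H¹(K_w, E[p^∞]) → H¹(K_{∞,η}, E[p^∞]))` is finite of order `1 = p^{ord_p c_w}`,
i.e. `LocalKernelOrderAt E p κ w` — Greenberg's Lemma 3.3 bound `#ker r_w ≤ c_w^{(p)}` (route p2,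
unconditional on the constructed objects) with `c_w^{(p)} = 1`.  No hypothesis on `E(K_w)[p]`.
[cite: GreenbergLNM1716, §3 Lemma 3.3 (p. 87) and §4 proof of Thm. 4.1 (p. 74)]
[cite: JetchevSkinnerWan2017, Prop. 3.3.4 Case 1(a)/2(a) (arXiv:1512.06894 pp. 12–13)] -/
theorem localKernelOrderAt_of_not_dvd_localTamagawaNumber (E : WeierstrassCurve K) [E.IsElliptic]
    (κ : ZpExtension K p) {v : HeightOneSpectrum (𝓞 K)} (hpv : ((p : ℕ) : 𝓞 K) ∉ v.asIdeal)
    (hc : ¬ p ∣ (E.baseChange (v.adicCompletion K)).localTamagawaNumber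
      (v.adicCompletionIntegers K)) :
    LocalKernelOrderAt E p κ v := by
  obtain ⟨hfin, hle⟩ := natCard_localKer_le_pow_padicValNat_localTamagawaNumber E κ hpv
  rw [padicValNat.eq_zero_of_not_dvd hc, pow_zero] at hle
  haveI := hfin
  haveI : Nonempty (localKer κ.kerSubgroup (E.geomPrimaryTorsion p) v) := ⟨0⟩
  refine ⟨hfin, ?_⟩
  rw [padicValNat.eq_zero_of_not_dvd hc, pow_zero]
  exact le_antisymm hle Nat.card_pos

end Local

/-! ## Glue at the places of `Σ(N⁺)` and class level -/

section ClassLevel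

variable {W : WeierstrassCurve ℚ} [W.IsElliptic] [W.IsGloballyMinimal] {K : Type} [Field K]
  [NumberField K] {p : ℕ} [Fact p.Prime]

omit [W.IsGloballyMinimal] [Fact p.Prime] in
/-- **`p ∤ c_ℓ(E)` at every bad `ℓ ≠ p` puts every `w ∈ Σ(N⁺)` in the Tamagawa-prime-to-`p` case**:
for `w ∈ Σ(N⁺)` (above a prime `ℓ ∣ N_E`, `ℓ ≠ p`, `e = f = 1`), `c_w(E/K) = c_ℓ(E)`
(`localTamagawaNumber_baseChange_eq_of_degree_one`), hence `p ∤ c_w(E/K)`.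
[cite: Castella2018, §5 (arXiv:1704.06608 p. 12), "`c_w = c_ℓ` at split `ℓ`"] [cite: GreenbergLNM1716, §3 pp. 74–75] -/
theorem not_dvd_localTamagawaNumber_nPlusPlaces
    (hT : ∀ (ℓ : ℕ) [Fact ℓ.Prime], ℓ ∣ W.conductorNorm ℤ → ℓ ≠ p →
      ¬ p ∣ (W.baseChange ((ratPlace ℓ).adicCompletion ℚ)).localTamagawaNumber
        ((ratPlace ℓ).adicCompletionIntegers ℚ))
    {v : HeightOneSpectrum (𝓞 K)} (hv : v ∈ nPlusPlaces W K p) :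
    ¬ p ∣ ((W.baseChange K).baseChange (v.adicCompletion K)).localTamagawaNumber
      (v.adicCompletionIntegers K) := by
  obtain ⟨hpv, hN, he, hf⟩ := (mem_nPlusPlaces_iff v).mp hv
  set ℓ : ℕ := (Rat.HeightOneSpectrum.primesEquiv (v.under (𝓞 ℚ)) : ℕ) with hℓdef
  haveI hℓ : Fact ℓ.Prime := ⟨(Rat.HeightOneSpectrum.primesEquiv (v.under (𝓞 ℚ))).2⟩
  have hℓv : ((ℓ : ℕ) : 𝓞 K) ∈ v.asIdeal := natCast_primesEquiv_under_mem v
  have hℓp : ℓ ≠ p := fun h ↦ hpv (h ▸ hℓv)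
  rw [localTamagawaNumber_baseChange_eq_of_degree_one W v he hf,
    localTamagawaNumber_congr_place (under_eq_ratPlace_of_mem hℓv)]
  exact hT ℓ hN hℓp

variable (W p)

omit [W.IsGloballyMinimal] in
/-- **The class-level atom (P11) of route R1 on the Tamagawa-prime-to-`p` population.**  If
`p ∤ c_ℓ(E)` for every prime `ℓ ∣ N_E` with `ℓ ≠ p`, then `R1LocalKernelOrderAt W p`: for every
imaginary quadratic `K`, every anticyclotomic `κ` and every `w ∈ Σ(N⁺)`, `#ker r_w = 1 = c_w^{(p)}`
(JSW17 Prop. 3.3.4 Case 1(a) / Greenberg p. 75 in the case `p ∤ c_w`; the torus part of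
`E(K_{∞,η})[p^∞]` is immaterial).  No hypothesis on `#E(ℚ_ℓ)[p]`.
[cite: JetchevSkinnerWan2017, Prop. 3.3.4 Case 1(a) (arXiv:1512.06894 pp. 12–13)] [cite: GreenbergLNM1716, §3 pp. 74–75, Lemma 3.3 (p. 87)] -/
theorem r1LocalKernelOrderAt_of_forall_not_dvd_tamagawa
    (hT : ∀ (ℓ : ℕ) [Fact ℓ.Prime], ℓ ∣ W.conductorNorm ℤ → ℓ ≠ p →
      ¬ p ∣ (W.baseChange ((ratPlace ℓ).adicCompletion ℚ)).localTamagawaNumber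
        ((ratPlace ℓ).adicCompletionIntegers ℚ)) :
    R1LocalKernelOrderAt W p := by
  intro K _ _ _ κ _ v hv
  exact localKernelOrderAt_of_not_dvd_localTamagawaNumber (W.baseChange K) κ
    ((mem_nPlusPlaces_iff v).mp hv).1 (not_dvd_localTamagawaNumber_nPlusPlaces hT hv)

/-- `LocallyTrivialAt W p` is the conjunction of the torsion condition and the Tamagawa condition; in
particular it implies the latter. [cite: GreenbergLNM1716, §3 pp. 74–75] -/
theorem LocallyTrivialAt.forall_not_dvd_tamagawa (hLT : LocallyTrivialAt W p) :
    ∀ (ℓ : ℕ) [Fact ℓ.Prime], ℓ ∣ W.conductorNorm ℤ → ℓ ≠ p →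
      ¬ p ∣ (W.baseChange ((ratPlace ℓ).adicCompletion ℚ)).localTamagawaNumber
        ((ratPlace ℓ).adicCompletionIntegers ℚ) :=
  fun ℓ _ hN hℓp ↦ (hLT ℓ hN hℓp).2

/-! ## Statement of record: (P11) consumed only where `p ∣ c_ℓ(E)` for some bad `ℓ ≠ p` -/

/-- **Route R1 — statement of record, (P11) restricted to the pairs with `p ∣ c_ℓ(E)` at some bad
`ℓ ≠ p`.**  For every globally minimal elliptic `W/ℚ` and prime `p` on `R1Population` with
`ord_{s=1} L(E,s) = 1`: `BSD(E,p)`, from the NINE PUBLISHED named facts of `R1.bsdp` (Gross–Zagier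
1986 I.7.3; GZK over `ℚ`; Skinner 2016 Thm. C; modularity; Cai–Shu–Tian 2014 Thm. 1.1;
Friedberg–Hoffstein, ramified form; Mazur 1978 on the Manin constant; Néron scaling), the FOUR CITED
cohomological facts (Poitou–Tate for Selmer structures, Howard 2.1.11 / Milne I 4.10(b); Poitou–Tate
duality of `Ш`; local Euler–Poincaré characteristic, Milne I 2.8; `cd_p(Γ_K) ≤ 2`, Serre II §4.4
Prop. 13), the typed LOCAL shape (P11) `R1LocalKernelOrderAt` ONLY on the pairs where `p ∣ c_ℓ(E)`
for some prime `ℓ ∣ N_E`, `ℓ ≠ p` (JSW17 Prop. 3.3.4 Case 1(a) with a non-trivial component part),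
and the ONE OPEN input `R1OpenInputOnTreeAt` ((IMC)∘(BDP) at `𝟙`, PREPRINT).  CONDITIONAL; deletes
nothing; X11b stays CONSTRUCTION-SHAPED; no label change.
[cite: Castella2018, Thm. 2.3 and §5 (arXiv:1704.06608 pp. 5, 12)] [cite: Castella2018Erratum, Thm. 1.1, Thm. A′ (p. 1)]
[cite: JetchevSkinnerWan2017, Thm. 3.3.1, Prop. 3.3.4 (arXiv:1512.06894 pp. 11–13)] [cite: GreenbergLNM1716, §3 Lemma 3.3 (p. 87)] -/
theorem R1.bsdp_of_onTree_facts_of_tamagawa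
    (hGZ : GrossZagier1986_thm_I_7_3) (hGZK : rank_eq_analyticRank_of_analyticRank_le_one)
    (hSk : Skinner2016.thmC_padicValRat_bsd_rank_zero) (hmod : exists_isNewformOf)
    (hCST : CaiShuTian2014.thm11_trivialChar)
    (hFH : friedbergHoffstein_exists_twist_ne_zero_ramifiedAt)
    (hMaz : mazur_not_dvd_maninConstant_of_odd) (hNS : integral_neronScaling_of_isGloballyMinimal)
    (hPT : ∀ (K : Type) [Field K] [NumberField K], poitouTate_selmerStructure_duality K)
    (hPT2 : ∀ (K : Type) [Field K] [NumberField K], poitouTate_sha_tateDual K)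
    (hEP : ∀ (K : Type) [Field K] [NumberField K] (v : HeightOneSpectrum (𝓞 K)),
      localEulerPoincareCharacteristic (v.adicCompletion K))
    (hcd : fieldCdLE_two_of_numberField)
    (h11 : ∀ (W : WeierstrassCurve ℚ) [W.IsElliptic] [W.IsGloballyMinimal] (p : ℕ) [Fact p.Prime],
      (∃ (ℓ : ℕ) (_ : Fact ℓ.Prime), ℓ ∣ W.conductorNorm ℤ ∧ ℓ ≠ p ∧
        p ∣ (W.baseChange ((ratPlace ℓ).adicCompletion ℚ)).localTamagawaNumber
          ((ratPlace ℓ).adicCompletionIntegers ℚ)) → R1LocalKernelOrderAt W p)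
    (hA : ∀ (W : WeierstrassCurve ℚ) [W.IsElliptic] [W.IsGloballyMinimal] (p : ℕ) [Fact p.Prime],
      R1OpenInputOnTreeAt W p)
    (hW : R1Population W p) (hr : W.analyticRank = 1) : BSDp W p := by
  refine R1.bsdp_of_onTree_facts W p hGZ hGZK hSk hmod hCST hFH hMaz hNS hPT hPT2 hEP hcd ?_ hA hW hr
  intro W _ _ p _ _
  by_cases hT : ∀ (ℓ : ℕ) [Fact ℓ.Prime], ℓ ∣ W.conductorNorm ℤ → ℓ ≠ p →
      ¬ p ∣ (W.baseChange ((ratPlace ℓ).adicCompletion ℚ)).localTamagawaNumber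
        ((ratPlace ℓ).adicCompletionIntegers ℚ)
  · exact r1LocalKernelOrderAt_of_forall_not_dvd_tamagawa W p hT
  · refine h11 W p ?_
    simp only [not_forall, not_not] at hT
    obtain ⟨ℓ, hℓ, hN, hℓp, hdvd⟩ := hT
    exact ⟨ℓ, hℓ, hN, hℓp, hdvd⟩

/-- **The same on a family of pairs all of which are Tamagawa-prime-to-`p`**: if every globally
minimal pair has `p ∤ c_ℓ(E)` at every bad `ℓ ≠ p` — the shape under which (P11) is never invoked —
then `BSD(E,p)` on `R1Population`, `r_an = 1`, from the nine published facts, the four cited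
cohomological facts and the ONE open input ONLY (no torsion condition `E(ℚ_ℓ)[p] = 0`, unlike
`R1.bsdp_of_onTree_facts_of_locallyTrivial`).
[cite: Castella2018, Thm. 2.3 (arXiv:1704.06608 p. 5)] [cite: GreenbergLNM1716, §3 Lemma 3.3 (p. 87)] -/
theorem R1.bsdp_of_onTree_facts_of_forall_tamagawa
    (hGZ : GrossZagier1986_thm_I_7_3) (hGZK : rank_eq_analyticRank_of_analyticRank_le_one)
    (hSk : Skinner2016.thmC_padicValRat_bsd_rank_zero) (hmod : exists_isNewformOf)
    (hCST : CaiShuTian2014.thm11_trivialChar)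
    (hFH : friedbergHoffstein_exists_twist_ne_zero_ramifiedAt)
    (hMaz : mazur_not_dvd_maninConstant_of_odd) (hNS : integral_neronScaling_of_isGloballyMinimal)
    (hPT : ∀ (K : Type) [Field K] [NumberField K], poitouTate_selmerStructure_duality K)
    (hPT2 : ∀ (K : Type) [Field K] [NumberField K], poitouTate_sha_tateDual K)
    (hEP : ∀ (K : Type) [Field K] [NumberField K] (v : HeightOneSpectrum (𝓞 K)),
      localEulerPoincareCharacteristic (v.adicCompletion K))
    (hcd : fieldCdLE_two_of_numberField)
    (hT : ∀ (W : WeierstrassCurve ℚ) [W.IsElliptic] [W.IsGloballyMinimal] (p : ℕ) [Fact p.Prime],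
      ∀ (ℓ : ℕ) [Fact ℓ.Prime], ℓ ∣ W.conductorNorm ℤ → ℓ ≠ p →
        ¬ p ∣ (W.baseChange ((ratPlace ℓ).adicCompletion ℚ)).localTamagawaNumber
          ((ratPlace ℓ).adicCompletionIntegers ℚ))
    (hA : ∀ (W : WeierstrassCurve ℚ) [W.IsElliptic] [W.IsGloballyMinimal] (p : ℕ) [Fact p.Prime],
      R1OpenInputOnTreeAt W p)
    (hW : R1Population W p) (hr : W.analyticRank = 1) : BSDp W p :=
  R1.bsdp_of_onTree_facts W p hGZ hGZK hSk hmod hCST hFH hMaz hNS hPT hPT2 hEP hcd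
    (fun W _ _ p _ _ ↦ r1LocalKernelOrderAt_of_forall_not_dvd_tamagawa W p (hT W p)) hA hW hr

end ClassLevel

end Summit.BirchSwinnertonDyer.Rank1Residual.X11b

end
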